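import Summits.AnomalousDissipation.AnomalousDissipation.Theorems.MomentParityQuarticGateCubicComplexify

/-!
# Complexified reduction for the axial Casimir stubs (line `axis-sectors` of crux `MomentParity.QuarticGate`), III

Single modes `δ_p x = Pi.single p x` in ONE slot of the conjugation-free forms of part I (the building
blocks for evaluating polarisations of the complexified Casimir expression at single-slot families):
* `ell_single`, `ell_single_of_not_mem` — `ℓ_v(δ_p x) = Σᵢ xᵢ v(-p)ᵢ` (`p ∈ S`), `0` (`p ∉ S`);
* `bracketForm_single_right` — `B_v(c, δ_q y) = Σᵢ (convectionCoeff S c v (-q))ᵢ yᵢ` (`q ∈ S = freqBall N`);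
* `bracketForm_single_left` — `B_v(δ_p x, c') = Σ_{m∈S, p+m∈S} (2πi x·m) Σᵢ v m i · c'(-(p+m)) i` (`p ∈ S`);
* `bracketForm_single_left_of_not_mem`, `bracketForm_single_right_of_not_mem` — vanishing off `S`.
-/

namespace Summit.AnomalousDissipation.AnomalousDissipation.Theorems.MomentParityQuarticGate

open MeasureTheory Filter
open scoped InnerProductSpace RealInnerProductSpace ComplexConjugate ENNReal
open Literature.Analysis.FunctionSpaces Literature.Analysis.FluidPDE
open Summit.AnomalousDissipation.AnomalousDissipation.Theses.MomentParity
open Summit.AnomalousDissipation.AnomalousDissipation.Theorems.QuarticGate.Negative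

-- `Summit.<Summit>.<Problem>` is the tree's mandated summit-side namespace (CONVENTIONS §2); for this
-- single-conjunct summit the two coincide, so the duplicate is deliberate.
set_option linter.dupNamespace false

noncomputable section

section Single

variable {N : ℕ}

/-- **The coordinate functional of a single mode**: for `p ∈ S`, `ℓ_v(δ_p x) = Σᵢ xᵢ · v(-p)ᵢ`. [folklore] -/
theorem ell_single {S : Finset (Fin 3 → ℤ)} {p : Fin 3 → ℤ} (hp : p ∈ S) (x : EuclideanSpace ℂ (Fin 3))
    (v : (Fin 3 → ℤ) → EuclideanSpace ℂ (Fin 3)) :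
    ∑ k ∈ S, ∑ i, (Pi.single p x : (Fin 3 → ℤ) → EuclideanSpace ℂ (Fin 3)) k i * v (-k) i = ∑ i, x i * v (-p) i := by
  rw [Finset.sum_eq_single p (fun k _ hk => Finset.sum_eq_zero fun i _ => by
      rw [show (Pi.single p x : (Fin 3 → ℤ) → EuclideanSpace ℂ (Fin 3)) k = 0 from Pi.single_eq_of_ne hk _]
      simp) (fun h => (h hp).elim)]
  rw [Pi.single_eq_same]

/-- A single mode outside `S` has vanishing coordinate functionals over `S`. [folklore] -/
theorem ell_single_of_not_mem {S : Finset (Fin 3 → ℤ)} {p : Fin 3 → ℤ} (hp : p ∉ S) (x : EuclideanSpace ℂ (Fin 3))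
    (v : (Fin 3 → ℤ) → EuclideanSpace ℂ (Fin 3)) :
    ∑ k ∈ S, ∑ i, (Pi.single p x : (Fin 3 → ℤ) → EuclideanSpace ℂ (Fin 3)) k i * v (-k) i = 0 := by
  refine Finset.sum_eq_zero fun k hk => Finset.sum_eq_zero fun i _ => ?_
  rw [show (Pi.single p x : (Fin 3 → ℤ) → EuclideanSpace ℂ (Fin 3)) k = 0 from
    Pi.single_eq_of_ne (fun h : k = p => hp (by rw [← h]; exact hk)) _]
  simp

/-- **The bracket form with a single mode in the second slot**: for `q ∈ S = freqBall N`,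
`B_v(c, δ_q y) = Σᵢ (convectionCoeff S c v (-q))ᵢ · yᵢ`. [folklore] -/
theorem bracketForm_single_right {q : Fin 3 → ℤ} (hq : q ∈ Torus.freqBall N)
    (c v : (Fin 3 → ℤ) → EuclideanSpace ℂ (Fin 3)) (y : EuclideanSpace ℂ (Fin 3)) :
    ∑ k ∈ Torus.freqBall N, ∑ i, (Torus.convectionCoeff (Torus.freqBall N) c v k) i *
        (Pi.single q y : (Fin 3 → ℤ) → EuclideanSpace ℂ (Fin 3)) (-k) i =
      ∑ i, (Torus.convectionCoeff (Torus.freqBall N) c v (-q)) i * y i := by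
  have hnegq : -q ∈ Torus.freqBall N := Torus.neg_mem_freqBall_of_mem q hq
  rw [Finset.sum_eq_single (-q) (fun k _ hk => Finset.sum_eq_zero fun i _ => by
      rw [show (Pi.single q y : (Fin 3 → ℤ) → EuclideanSpace ℂ (Fin 3)) (-k) = 0 from
        Pi.single_eq_of_ne (fun h => hk (by rw [← h, neg_neg])) _]
      simp) (fun h => (h hnegq).elim)]
  rw [neg_neg, Pi.single_eq_same]

/-- A single mode outside `S` in the second slot gives a vanishing bracket form. [folklore] -/
theorem bracketForm_single_right_of_not_mem {q : Fin 3 → ℤ} (hq : q ∉ Torus.freqBall N)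
    (c v : (Fin 3 → ℤ) → EuclideanSpace ℂ (Fin 3)) (y : EuclideanSpace ℂ (Fin 3)) :
    ∑ k ∈ Torus.freqBall N, ∑ i, (Torus.convectionCoeff (Torus.freqBall N) c v k) i *
        (Pi.single q y : (Fin 3 → ℤ) → EuclideanSpace ℂ (Fin 3)) (-k) i = 0 := by
  refine Finset.sum_eq_zero fun k hk => Finset.sum_eq_zero fun i _ => ?_
  rw [show (Pi.single q y : (Fin 3 → ℤ) → EuclideanSpace ℂ (Fin 3)) (-k) = 0 from
    Pi.single_eq_of_ne (fun h => hq (by rw [← h]; exact Torus.neg_mem_freqBall_of_mem k hk)) _]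
  simp

/-- **The bracket form with a single mode in the first (advecting) slot**: for `p ∈ S = freqBall N`,
`B_v(δ_p x, c') = Σ_{m ∈ S, p + m ∈ S} (2πi (x·m)) · Σᵢ v m i · c'(-(p+m)) i` (the mode `p` advects the
test frequency `m` into `p + m`). [folklore] -/
theorem bracketForm_single_left {p : Fin 3 → ℤ} (hp : p ∈ Torus.freqBall N) (x : EuclideanSpace ℂ (Fin 3))
    (v c' : (Fin 3 → ℤ) → EuclideanSpace ℂ (Fin 3)) :
    ∑ k ∈ Torus.freqBall N, ∑ i, (Torus.convectionCoeff (Torus.freqBall N) (Pi.single p x) v k) i * c' (-k) i =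
      ∑ m ∈ Torus.freqBall N, if p + m ∈ Torus.freqBall N then
        (2 * Real.pi * Complex.I * ∑ j, x j * (m j : ℂ)) * ∑ i, v m i * c' (-(p + m)) i else 0 := by
  classical
  simp_rw [convectionCoeff_single_left hp]
  have hswap : ∀ k : Fin 3 → ℤ, ∑ i, (∑ m ∈ Torus.freqBall N,
      (if p + m = k then (2 * Real.pi * Complex.I * ∑ j, x j * (m j : ℂ)) • v m else 0)) i * c' (-k) i =
      ∑ m ∈ Torus.freqBall N, if p + m = k then
        (2 * Real.pi * Complex.I * ∑ j, x j * (m j : ℂ)) * ∑ i, v m i * c' (-k) i else 0 := by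
    intro k
    simp only [WithLp.ofLp_sum, Finset.sum_apply, Finset.sum_mul]
    rw [Finset.sum_comm]
    refine Finset.sum_congr rfl fun m _ => ?_
    by_cases h : p + m = k
    · simp only [if_pos h, WithLp.ofLp_smul, Pi.smul_apply, smul_eq_mul, Finset.mul_sum]
      exact Finset.sum_congr rfl fun i _ => by ring
    · simp only [if_neg h, WithLp.ofLp_zero, Pi.zero_apply, zero_mul, Finset.sum_const_zero]
  simp_rw [hswap]
  rw [Finset.sum_comm]
  refine Finset.sum_congr rfl fun m _ => ?_
  rw [Finset.sum_ite_eq]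

/-- A single mode outside `S` in the first slot gives a vanishing bracket form. [folklore] -/
theorem bracketForm_single_left_of_not_mem {S : Finset (Fin 3 → ℤ)} {p : Fin 3 → ℤ} (hp : p ∉ S)
    (x : EuclideanSpace ℂ (Fin 3)) (v c' : (Fin 3 → ℤ) → EuclideanSpace ℂ (Fin 3)) :
    ∑ k ∈ S, ∑ i, (Torus.convectionCoeff S (Pi.single p x) v k) i * c' (-k) i = 0 := by
  have h0 : Torus.convectionCoeff S (Pi.single p x) v = 0 := by
    funext k
    rw [Torus.convectionCoeff_def]
    refine Finset.sum_eq_zero fun l hl => Finset.sum_eq_zero fun m _ => ?_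
    rw [show (Pi.single p x : (Fin 3 → ℤ) → EuclideanSpace ℂ (Fin 3)) l = 0 from
      Pi.single_eq_of_ne (fun h : l = p => hp (by rw [← h]; exact hl)) _]
    simp
  simp [h0]

end Single

end

/-! ## Registered sub-goal (summary) -/

/-- **Registered sub-goal `cubicComplexify_bracketForm_single_left` (summary of this file)**: for a single
advecting mode `δ_p x = Pi.single p x`, `p ∈ S = freqBall N`, any test family `v` and any second family `c'`,
`B_v(δ_p x, c') = Σ_{m ∈ S} [p + m ∈ S] (2πi Σⱼ xⱼ mⱼ) · Σᵢ v m i · c'(-(p+m)) i`. [folklore] -/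
theorem cubicComplexify_bracketForm_single_left : ∀ (N : ℕ) (p : Fin 3 → ℤ) (x : EuclideanSpace ℂ (Fin 3)) (v c' : (Fin 3 → ℤ) → EuclideanSpace ℂ (Fin 3)), p ∈ Torus.freqBall N → ∑ k ∈ Torus.freqBall N, ∑ i, (Torus.convectionCoeff (Torus.freqBall N) (Pi.single p x) v k) i * c' (-k) i = ∑ m ∈ Torus.freqBall N, if p + m ∈ Torus.freqBall N then (2 * Real.pi * Complex.I * ∑ j, x j * (m j : ℂ)) * ∑ i, v m i * c' (-(p + m)) i else 0 :=
  fun _ _ x v c' hp => bracketForm_single_left hp x v c'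

end Summit.AnomalousDissipation.AnomalousDissipation.Theorems.MomentParityQuarticGate
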